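import Mathlib
import HarnessLib

-- provenance: harness21/H21/H21/Statements/PNP/Wave0.lean @ 7bcf3cf (interim HEAD d8f2665); M5 mechanical rewrite
/-!
# P versus NP family (`pnp`) — wave 0 statements

Family: `pnp` (peak: P ≠ NP in Cook's Clay formulation). Trunks touched: T-CPLX-CORE
(classes P, NP, Karp reductions) and T-CPLX-ALG (determinantal complexity).

## Covered statement ids

* **pnp.S07** — the class `P` (Cook, Clay problem description §1), as `Literature.Computability.Complexity.PNPWave0.P`.
* **pnp.S08** — the class `NP` via polynomial-time checking relations (Cook, Clay §1), as
  `Literature.Computability.Complexity.PNPWave0.NP`.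
* **pnp.S01** — the conjecture P ≠ NP (Cook, Clay §1; Cook 1971), as the `Prop`
  `Literature.PNP.PNeNP`.
* **pnp.S11** — closure of `P` under `≤ₚ` (Cook, Clay Prop. 1(a)) and transitivity of `≤ₚ`
  (Cook, Clay §2, remark preceding Prop. 1; Arora–Barak Thm. 2.8(1)), as named facts.
* **pnp.S06** — the Mignon–Ressayre / Cai–Chen–Li lower bound `dc(PER_n) ≥ n² / 2`, as a
  named fact.

## Skipped (34 of 39) and why

* pnp.S05 (dc(PER_n) not polynomially bounded): statable with the glue below, skipped only
  because of the five-statement cap of this wave.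
* pnp.S02, S15, S16, S18, S20–S24, S33: need Boolean circuits / P/poly / constant-depth classes
  (notion `boolean_circuit`, absent from Mathlib, size M).
* pnp.S03, S04, S25, S26, S29, S39: need arithmetic circuits and Valiant's classes VP/VNP
  (`arithmetic_circuit`, M).
* pnp.S09, S10, S30, S31, S32, S34, S36: need propositional formulas / CNF-SAT as a language with
  a fixed binary encoding, resp. proof systems (`cnf_sat_language`, `frege_ef_resolution`).
* pnp.S12, S17, S19: need time-bounded oracle Turing machines (`oracle_tm`, M: surgery on
  `Turing.TM2`).
* pnp.S13, S14, S37: need DTIME(t) with a fixed machine model, time-constructibility and space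
  bounds (`space_bounded_classes`, M).
* pnp.S24, S35: need probabilistic machines / PCP verifiers (`ppt_machine`, `pcp_verifier`).
* pnp.S27, S28: need the GL-action on forms and orbit closures (`gct_orbit_closure`), and for
  S28 highest-weight theory (`gl_sn_irreps_partitions`, L).
* pnp.S38: needs bounded arithmetic theories (L).

## Design choices

* Machine model: Mathlib's bundled multi-stack machines `Turing.FinTM2` with the `Type`-valued
  certificate `Turing.TM2ComputableInPolyTime`; we turn it into a `Prop` with `Nonempty`.
  Words over a finite alphabet `Γ` are encoded by themselves (`id : List Γ → List Γ`), Booleans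
  by `Computability.encodeBool`. Cook's bound `T_M(n) ≤ n ^ k + k` is replaced by an arbitrary
  `Polynomial ℕ` bound (equivalent). One TM2 step is one `Stmt`; polynomial time is robust
  under this change of model.
* `P Γ` and `NP Γ` are sets of `Language Γ` for an arbitrary finite alphabet `Γ` (Cook fixes a
  finite alphabet `Σ` with at least two elements; the peak statement uses `Γ = Bool`).
* Cook's checking relation `R ⊆ Σ* × Σ₁*` is polynomial-time iff the language
  `{w # y | R w y}` over `Σ ∪ Σ₁ ∪ {#}` is in P. We take `Σ₁ = Σ = Γ` and realise `#` as
  `none : Option Γ`, see `Literature.Computability.Complexity.pairWord`.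
* Determinantal complexity `dc f` is the least `m` such that `f = det A` for an `m × m` matrix
  `A` of polynomials of total degree `≤ 1` (affine linear forms), following Mignon–Ressayre.
  It is an `sInf` over `ℕ`; the set is nonempty over a field (Valiant 1979, universality of the
  determinant), so the junk value `0` for an empty set never occurs in the statements here.
-/

namespace Literature.Computability.Complexity

open _root_.Computability

/-! ### Polynomial-time functions and the class P (pnp.S07) -/

section Classes

variable {Γ Γ' : Type} [Fintype Γ] [Fintype Γ']

/-- A function on words `f : List Γ → List Γ'` between finite alphabets is *polynomial-time
computable* if some bundled multi-stack Turing machine (`Turing.FinTM2`) computes it within a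
polynomial number of steps in the input length, i.e. Mathlib's certificate type
`Turing.TM2ComputableInPolyTime id id f` is inhabited. (Cook, Clay problem description §1,
"polynomial-time computable function"; Mathlib `Turing.TM2ComputableInPolyTime`.) [folklore] -/
def IsPolyTime (f : List Γ → List Γ') : Prop :=
  Nonempty (Turing.TM2ComputableInPolyTime (id : List Γ → List Γ) (id : List Γ' → List Γ') f)

/-- A Boolean-valued function on words `f : List Γ → Bool` is *polynomial-time decidable* if a
`Turing.FinTM2` computes it in polynomial time, the output being encoded by
`Computability.encodeBool`. (Cook, Clay §1: `M` accepts/rejects `w` within `T_M(|w|)` steps.) [folklore] -/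
def IsPolyTimePred (f : List Γ → Bool) : Prop :=
  Nonempty (Turing.TM2ComputableInPolyTime (id : List Γ → List Γ) encodeBool f)

variable (Γ) in
/-- **pnp.S07** (the class P; Cook, Clay problem description §1). `P = {L(M) | M` a
deterministic Turing machine running in time `≤ n ^ k + k` for some `k}`. Here: the set of
languages `L` over the finite alphabet `Γ` whose characteristic function is computed by some
`Turing.FinTM2` in polynomial time. [folklore] -/
def PNPWave0.P : Set (Language Γ) :=
  {L | ∃ f : List Γ → Bool, IsPolyTimePred f ∧ ∀ w, w ∈ L ↔ f w = true}

/-- The word `w # y` over the alphabet `Γ ∪ {#}`, realised as `Option Γ` with `# = none`: the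
encoding of a pair of words used for Cook's checking relations (Cook, Clay §1, the language
`L_R = {w # y | R(w, y)}`). [folklore] -/
def pairWord (w y : List Γ) : List (Option Γ) :=
  w.map some ++ none :: y.map some

/-- A binary relation `R` on words over `Γ` is a *polynomial-time checking relation* if the
language `L_R = {w # y | R w y}` over `Γ ∪ {#}` is in `P` (Cook, Clay problem description §1). [folklore] -/
def IsPolyTimeCheckingRelation (R : List Γ → List Γ → Prop) : Prop :=
  {u : List (Option Γ) | ∃ w y, u = pairWord w y ∧ R w y} ∈ PNPWave0.P (Option Γ)

variable (Γ) in
/-- **pnp.S08** (the class NP; Cook, Clay problem description §1). A language `L` over `Γ` is in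
NP iff there are `k : ℕ` and a polynomial-time checking relation `R` such that for all words
`w`, `w ∈ L ↔ ∃ y, |y| ≤ |w| ^ k ∧ R(w, y)`. [folklore] -/
def PNPWave0.NP : Set (Language Γ) :=
  {L | ∃ (k : ℕ) (R : List Γ → List Γ → Prop), IsPolyTimeCheckingRelation R ∧
    ∀ w, w ∈ L ↔ ∃ y : List Γ, y.length ≤ w.length ^ k ∧ R w y}

/-! ### Polynomial-time reductions (pnp.S11) -/

/-- Polynomial-time many-one (Karp) reducibility `L₁ ≤ₚ L₂` between languages over finite
alphabets: there is a polynomial-time computable `f : List Γ → List Γ'` with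
`w ∈ L₁ ↔ f w ∈ L₂` for all `w` (Cook, Clay problem description §2; Karp 1972). Mathlib has only
the unbounded analogue `ManyOneReducible`. [cite: Karp1972] -/
def PNPWave0.PolyTimeReducible (L₁ : Language Γ) (L₂ : Language Γ') : Prop :=
  ∃ f : List Γ → List Γ', IsPolyTime f ∧ ∀ w, w ∈ L₁ ↔ f w ∈ L₂

@[inherit_doc] scoped[Literature.Computability.Complexity.PNPWave0] infix:50 " ≤ₚ " => PNPWave0.PolyTimeReducible  -- was `scoped` in `Literature.PNP`; the CplxCore ≤ₚ (Karp, `…Complexity.Notation`) now shares this namespace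
open scoped Literature.Computability.Complexity.PNPWave0

/-- **pnp.S11** (part 1; Cook, Clay problem description, Proposition 1(a)). If `L₁ ≤ₚ L₂` and
`L₂ ∈ P` then `L₁ ∈ P`. Proof in print: compose the reduction with the decider; polynomials are
closed under composition (cf. Mathlib's `proof_wanted TM2ComputableInPolyTime.comp`). [cite: CookClay2006, Proposition 1(a)] -/
def mem_P_of_polyTimeReducible : Prop :=
  ∀ {L₁ : Language Γ} {L₂ : Language Γ'} (h : L₁ ≤ₚ L₂) (h₂ : L₂ ∈ PNPWave0.P Γ'),
    L₁ ∈ PNPWave0.P Γ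

/-- **pnp.S11** (part 2; Cook, Clay problem description, §2, remark preceding Proposition 1:
"Part (b) uses the transitivity of ≤ₚ"; Arora–Barak, *Computational Complexity*, Thm. 2.8(1)).
Polynomial-time reducibility is transitive: `L₁ ≤ₚ L₂ → L₂ ≤ₚ L₃ → L₁ ≤ₚ L₃`.
[cite: AroraBarakCC2009, Thm. 2.8(1)] -/
def PNPWave0.PolyTimeReducible.trans : Prop :=
  ∀ {Γ'' : Type} [Fintype Γ''] {L₁ : Language Γ} {L₂ : Language Γ'} {L₃ : Language Γ''} (h₁₂ : L₁ ≤ₚ L₂) (h₂₃ : L₂ ≤ₚ L₃),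
    L₁ ≤ₚ L₃

end Classes

/-! ### Determinantal complexity of the permanent (pnp.S06) -/

section Determinantal

open MvPolynomial

variable {K : Type*} [CommRing K] {σ : Type*}

/-- The *determinantal complexity* `dc f` of a polynomial `f`: the least `m` such that
`f = det A` for some `m × m` matrix `A` whose entries are polynomials of total degree `≤ 1`
(affine linear forms in the variables). (Mignon–Ressayre 2004, §1; Bürgisser 2000, §2.5.)
Defined as an `sInf` over `ℕ`; junk value `0` if no such `m` exists, which does not happen over
a field (Valiant 1979). [cite: MignonRessayre2004, §1] -/
noncomputable def determinantalComplexity (f : MvPolynomial σ K) : ℕ :=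
  sInf {m : ℕ | ∃ A : Matrix (Fin m) (Fin m) (MvPolynomial σ K),
    (∀ i j, (A i j).totalDegree ≤ 1) ∧ A.det = f}

variable (K) in
/-- The generic `n × n` permanent polynomial `PER_n = ∑_{π ∈ 𝔖ₙ} ∏ᵢ X_{π i, i}` in the `n²`
variables `X_{i j}`, as the permanent (`Matrix.permanent`) of Mathlib's generic matrix
`Matrix.mvPolynomialX`. (Valiant 1979; Bürgisser 2000, (2.2).) [cite: Valiant1979] -/
noncomputable def per (n : ℕ) : MvPolynomial (Fin n × Fin n) K :=
  (Matrix.mvPolynomialX (Fin n) (Fin n) K).permanent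

/-- **pnp.S06** (Mignon–Ressayre 2004, main Theorem; quoted as Cai–Chen–Li 2010, Thm. 2.2 and
Landsberg 2017, Thm. 6.4.6.4: "For any field of characteristic 0, `dc(per_n) ≥ n²/2`"). Over a
field of characteristic `0`, the determinantal complexity of the `n × n` permanent satisfies
`dc(PER_n) ≥ n² / 2` for `n ≥ 3` (stated as `n ^ 2 ≤ 2 · dc`).

RESTATED 2026-08-15 (work item `wi-07998`; same name, constant and range, hypothesis corrected to
what the source proves — exactly as its twin
`Literature.Computability.AlgebraicComplexity.sq_le_two_mul_determinantalComplexity_perPoly` was):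
the wave-0 version quantified over every field of characteristic `≠ 2` (`ringChar F ≠ 2`), citing
"Cai–Chen–Li 2010, Theorem 1" for positive characteristic; that source proves in odd characteristic
`p` only `(n-2)(n-3) ≤ 2 · dc(per_{n+1})` for `p ∣ n + 1` or `p ∣ n + 2` (Thm. 2.3 / Cor. 2.4:
infinitely many `n` per odd prime), and Mignon–Ressayre's Hessian computation at `y₀ = J - n·E₁₁`
is characteristic `0` (Landsberg 2017, §6.4.6), so `n² / 2` for all `n ≥ 3` in odd characteristic
is unsupported by both sources (details: `PNPWave0MignonRessayre.lean`, module docstring). The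
declaration has no users outside docstrings. DISCHARGED downstream, where the proof can import
this file: `sq_le_two_mul_determinantalComplexity_per_holds` (`PNPWave0MignonRessayre.lean`, from
`sq_le_two_mul_determinantalComplexity_per_of_ringChar_eq_zero` there, i.e. from the tree's proof
of the Mignon–Ressayre bound, `MignonRessayreBound.lean`).
[cite: MignonRessayre2004, main Theorem] [cite: CaiChenLi2010, Thm. 2.2 (quoting Mignon–Ressayre); Thm. 2.3 and Cor. 2.4 (what is proved in odd characteristic)] -/
def sq_le_two_mul_determinantalComplexity_per : Prop :=
  ∀ {F : Type*} [Field F] (hF : ringChar F = 0) {n : ℕ} (hn : 3 ≤ n),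
    n ^ 2 ≤ 2 * determinantalComplexity (per F n)

end Determinantal

end Literature.Computability.Complexity
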